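import Mathlib

/-!
# SEIL-F outer end: the polar substitution `u = R sin²θ` for the roll species (solo-blind s86, kernel #194)

LEMMA R of the outer theorem (PLAN §107 (j)–(l)) writes the roll block of the deleted leaf chain
in the physical polar angle: the roll coefficients `r_k` are the coefficients on the Gegenbauer
basis `C^{(2)}_{k-2}(cos θ)`, on which the `O(P)` Doppler chain is multiplication by `2 cos θ`
(kernel #186) and the damping `-K₀ k²` is `K₀ (L₂ - 4)` with the Gegenbauer-2 operator
`L₂ R = R'' + 4 cot θ · R'`.  The first-order polar drift `4 cot θ ∂_θ` is what defeats a
leading-order WKB treatment of the roll profile (D67).  The cure used from D68 on is the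
substitution `u := R sin²θ`, which removes the drift EXACTLY and turns the damping into the
Pöschl–Teller operator `∂² - 2/sin²θ`:

  `sin²θ · (L₂ R)(θ) = u''(θ) + (4 - 2/sin²θ) u(θ)`,  i.e.  `sin²θ · (L₂ - 4) R = u'' - 2u/sin²θ`.

This file certifies (i) the product-rule derivatives of `u = R sin²` (first and second),
(ii) the algebraic identity behind the substitution over any field (so it applies verbatim to
the complex roll coefficients), (iii) the combined statement for real `C²` data, and (iv) the
lowest mode check `u₂ = sin²θ`: `u₂'' - 2u₂/sin²θ = -4 u₂` (`k = 2`, eigenvalue `-k²`).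
-/

namespace Summit.AnomalousDissipation.AnomalousDissipation.Theorems

/-- The algebra of the polar substitution: with `s = sin θ ≠ 0`, `c = cos θ`, `s² + c² = 1`,
and `r0, r1, r2` the values of `R, R', R''`, the second derivative of `u = R s²`
(`= r2 s² + 4 r1 s c + 2 r0 (c² - s²)`) satisfies
`u'' + (4 - 2/s²) u = s² (r2 + 4 (c/s) r1) = s² · L₂R`. -/
theorem rollPolar_algebra {K : Type*} [Field K] (s c r0 r1 r2 : K) (hs : s ≠ 0)
    (hsc : s ^ 2 + c ^ 2 = 1) :
    (r2 * s ^ 2 + 4 * r1 * s * c + 2 * r0 * (c ^ 2 - s ^ 2)) + (4 - 2 / s ^ 2) * (r0 * s ^ 2)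
      = s ^ 2 * (r2 + 4 * (c / s) * r1) := by
  have hc : c ^ 2 = 1 - s ^ 2 := by linear_combination hsc
  field_simp
  rw [hc]
  ring

/-- Pöschl–Teller form of the same identity: `u'' - 2u/s² = s² · (L₂R - 4R)`. -/
theorem rollPolar_algebra' {K : Type*} [Field K] (s c r0 r1 r2 : K) (hs : s ≠ 0)
    (hsc : s ^ 2 + c ^ 2 = 1) :
    (r2 * s ^ 2 + 4 * r1 * s * c + 2 * r0 * (c ^ 2 - s ^ 2)) - 2 / s ^ 2 * (r0 * s ^ 2)
      = s ^ 2 * ((r2 + 4 * (c / s) * r1) - 4 * r0) := by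
  have hc : c ^ 2 = 1 - s ^ 2 := by linear_combination hsc
  field_simp
  rw [hc]
  ring

/-- First derivative of `u = R · sin²`. -/
theorem rollPolar_hasDerivAt_u {R R' : ℝ → ℝ} {θ : ℝ} (hR : HasDerivAt R (R' θ) θ) :
    HasDerivAt (fun x => R x * Real.sin x ^ 2)
      (R' θ * Real.sin θ ^ 2 + R θ * (2 * Real.sin θ * Real.cos θ)) θ := by
  have hs2 : HasDerivAt (fun x => Real.sin x ^ 2) (2 * Real.sin θ * Real.cos θ) θ := by
    have h := (Real.hasDerivAt_sin θ).mul (Real.hasDerivAt_sin θ)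
    exact (h.congr_deriv (by ring)).congr_of_eventuallyEq
      (Filter.Eventually.of_forall fun y => by
        simp only [Pi.mul_apply]; ring)
  have h := hR.mul hs2
  exact (h.congr_deriv (by ring)).congr_of_eventuallyEq
    (Filter.Eventually.of_forall fun y => by
      simp only [Pi.mul_apply])

/-- Second derivative of `u = R · sin²`: if `R' ` is the derivative of `R` everywhere and
`R''(θ)` the derivative of `R'` at `θ`, then `u' = R' sin² + 2 R sin cos` has derivative
`R'' sin² + 4 R' sin cos + 2 R (cos² - sin²)` at `θ`. -/
theorem rollPolar_hasDerivAt_u' {R R' R'' : ℝ → ℝ} {θ : ℝ} (hR : ∀ x, HasDerivAt R (R' x) x)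
    (hR' : HasDerivAt R' (R'' θ) θ) :
    HasDerivAt (fun x => R' x * Real.sin x ^ 2 + R x * (2 * Real.sin x * Real.cos x))
      (R'' θ * Real.sin θ ^ 2 + 4 * R' θ * Real.sin θ * Real.cos θ
        + 2 * R θ * (Real.cos θ ^ 2 - Real.sin θ ^ 2)) θ := by
  have hs2 : HasDerivAt (fun x => Real.sin x ^ 2) (2 * Real.sin θ * Real.cos θ) θ := by
    have h := (Real.hasDerivAt_sin θ).mul (Real.hasDerivAt_sin θ)
    exact (h.congr_deriv (by ring)).congr_of_eventuallyEq
      (Filter.Eventually.of_forall fun y => by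
        simp only [Pi.mul_apply]; ring)
  have hsc : HasDerivAt (fun x => 2 * Real.sin x * Real.cos x)
      (2 * Real.cos θ * Real.cos θ + 2 * Real.sin θ * (-Real.sin θ)) θ := by
    have h := ((Real.hasDerivAt_sin θ).mul (Real.hasDerivAt_cos θ)).const_mul (2 : ℝ)
    exact (h.congr_deriv (by ring)).congr_of_eventuallyEq
      (Filter.Eventually.of_forall fun y => by
        simp only [Pi.mul_apply]; ring)
  have h := (hR'.mul hs2).add ((hR θ).mul hsc)
  exact (h.congr_deriv (by ring)).congr_of_eventuallyEq
    (Filter.Eventually.of_forall fun y => by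
      simp only [Pi.mul_apply, Pi.add_apply])

/-- The polar substitution for real `C²` data: with `u = R sin²`,
`u''(θ) + (4 - 2/sin²θ) u(θ) = sin²θ · (R''(θ) + 4 cot θ · R'(θ))` wherever `sin θ ≠ 0`;
here `u''(θ)` is the value certified by `rollPolar_hasDerivAt_u'`. -/
theorem rollPolar_substitution {R R' R'' : ℝ → ℝ} {θ : ℝ} (hθ : Real.sin θ ≠ 0) :
    (R'' θ * Real.sin θ ^ 2 + 4 * R' θ * Real.sin θ * Real.cos θ
        + 2 * R θ * (Real.cos θ ^ 2 - Real.sin θ ^ 2))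
      + (4 - 2 / Real.sin θ ^ 2) * (R θ * Real.sin θ ^ 2)
      = Real.sin θ ^ 2 * (R'' θ + 4 * (Real.cos θ / Real.sin θ) * R' θ) :=
  rollPolar_algebra _ _ _ _ _ hθ (Real.sin_sq_add_cos_sq θ)

/-- Lowest roll mode in the `u`-picture: `u₂ = sin²θ` (`C^{(2)}_0 = 1`) is a Pöschl–Teller
eigenfunction, `u₂'' - 2 u₂/sin²θ = -4 u₂` (`-k²` with `k = 2`), where
`u₂'' = 2 (cos²θ - sin²θ)` by `rollPolar_hasDerivAt_u'` with `R ≡ 1`. -/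
theorem rollPolar_mode_two {θ : ℝ} (hθ : Real.sin θ ≠ 0) :
    2 * (Real.cos θ ^ 2 - Real.sin θ ^ 2) - 2 / Real.sin θ ^ 2 * Real.sin θ ^ 2
      = -4 * Real.sin θ ^ 2 := by
  have hsc := Real.sin_sq_add_cos_sq θ
  have hc : Real.cos θ ^ 2 = 1 - Real.sin θ ^ 2 := by linear_combination hsc
  field_simp
  rw [hc]
  ring

end Summit.AnomalousDissipation.AnomalousDissipation.Theorems
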